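import Summits.AtomisticToContinuum.Crystallization.Theses.DisclinationRation
import Summits.AtomisticToContinuum.Crystallization.Theorems.HullExactificationCascadeHullGoodEverywhere
import Summits.AtomisticToContinuum.Crystallization.Theorems.HullExactificationCascadeHullExactShellsShells
import Summits.AtomisticToContinuum.Crystallization.Theorems.DisclinationRationAlphabetGoodHullElementStubCensusCleanHullElementAux
import HarnessLib

/-!
# Crux `AlphabetGoodHullElement` (stmt-AtomisticToContinuum-15798), line `census-liouville` —
# stub `stub_censusCleanHullElement` (B: a census-clean hull element with bounded scale)

EXACTIFICATION no. 1 for the wide-window link census `CC`: if the census-dirty fraction of a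
sequence `x N` of Lennard-Jones ground states in `ℝ³` tends to `0`, some hull element `S ∋ 0` of
`x` (two-way matching of translates `x (φ j) + τ j` with `S` on every ball, eventually in `j`) is
`δ`-separated and EVERY `y ∈ S` is census-clean with local scale `dist(y, S ∖ {y}) ≤ R₀`.

As in the helper file, the census is parametrised (`nnd`, `win`, `rng`, `G` pinned by `hnnd`,
`hwin`, `hrng`, `hG`; the stub instantiates them with the line's inlined terms by `rfl`).  The
frame is that of `hullGoodEverywhere_proof` (stmt-12089) / `agce_clean_generic`: clean centres of
every radius by pigeonhole (`hb_exists_far_from`), diagonal radii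
(`Filter.extraction_forall_of_eventually`), recentring, compactness of uniformly discrete point
sets (`exists_subseq_forall_eventually_ballMatch`), scale bound from the bond radius
(`hge_exists_bond_radius`).  What changes is the passage to the limit, done in two rounds:
(1) at every point `y` of the local limit `S` the BUFFER clause and the scale bounds hold
(`cche_limit_buf`: every `y ∈ S` is followed back along census-clean approximants; a point of `S`
in the open annulus `(61/50·d, 13/10·d)` of `y` would have partners violating the buffer of the
approximants at every matching precision — `cche_static_buf` + `cche_or_of_forall_small`);
(2) with the buffers in place on both sides, ONE matching at precision `δ/200` transfers the whole
census from a clean approximant to `y` (`cche_clean_transfer`, the limit-free collar transfer: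
windows, rings and five-sets inject into each other along the matching, pattern of
`cleR_gappedTwelve_transfer`).
-/

noncomputable section

namespace Summit.AtomisticToContinuum.Crystallization.Theorems.AlphabetGoodHullElementCensusLiouville

open Summit.AtomisticToContinuum.Crystallization.Theorems.HullExactShells (norm_le_norm_add_dist)
open Literature.MathematicalPhysics.StatisticalMechanics
open Filter Topology Metric

variable {nnd : Set (EuclideanSpace ℝ (Fin 3)) → EuclideanSpace ℝ (Fin 3) → ℝ}
  {win : Set (EuclideanSpace ℝ (Fin 3)) → EuclideanSpace ℝ (Fin 3) → Set (EuclideanSpace ℝ (Fin 3))}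
  {rng : Set (EuclideanSpace ℝ (Fin 3)) → EuclideanSpace ℝ (Fin 3) → EuclideanSpace ℝ (Fin 3) →
    Set (EuclideanSpace ℝ (Fin 3))}
  {G : Set (EuclideanSpace ℝ (Fin 3)) → EuclideanSpace ℝ (Fin 3) → Prop}
  (hnnd : ∀ S y, nnd S y = sInf ((fun z => dist z y) '' (S \ {y})))
  (hwin : ∀ S y, win S y =
    {z : EuclideanSpace ℝ (Fin 3) | z ∈ S ∧ z ≠ y ∧ dist z y ≤ 61 / 50 * nnd S y})
  (hrng : ∀ S y z, rng S y z =
    {w : EuclideanSpace ℝ (Fin 3) | w ∈ win S y ∧ w ≠ z ∧ dist w z ≤ 61 / 50 * nnd S z})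
  (hG : ∀ S y, G S y ↔
    (∀ z ∈ S, dist z y ≤ 61 / 50 * nnd S y ∨ 13 / 10 * nnd S y ≤ dist z y) ∧ (win S y).ncard = 12 ∧
      (∀ z ∈ win S y, (rng S y z).ncard = 4 ∨ (rng S y z).ncard = 5) ∧
      ({z : EuclideanSpace ℝ (Fin 3) | z ∈ win S y ∧ (rng S y z).ncard = 5}.ncard = 0 ∨
        {z : EuclideanSpace ℝ (Fin 3) | z ∈ win S y ∧ (rng S y z).ncard = 5}.ncard = 2))

/-! ## Round 1: buffers and scale bounds pass to local limits -/

/-- A closed alternative survives vanishing two-sided errors: if `a ≤ b + 5η ∨ c - 5η ≤ a` for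
all small `η > 0`, then `a ≤ b ∨ c ≤ a`. [folklore] -/
theorem cche_or_of_forall_small {a b c η₀ : ℝ} (hη₀ : 0 < η₀)
    (h : ∀ η : ℝ, 0 < η → η < η₀ → (a ≤ b + 5 * η ∨ c - 5 * η ≤ a)) : a ≤ b ∨ c ≤ a := by
  by_contra hcon
  rw [not_or, not_le, not_le] at hcon
  obtain ⟨hba, hac⟩ := hcon
  set η : ℝ := min (η₀ / 2) (min ((a - b) / 6) ((c - a) / 6)) with hη
  have hη0 : 0 < η := lt_min (by linarith) (lt_min (by linarith) (by linarith))
  have h1 : η ≤ η₀ / 2 := min_le_left _ _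
  have h2 : η ≤ (a - b) / 6 := (min_le_right _ _).trans (min_le_left _ _)
  have h3 : η ≤ (c - a) / 6 := (min_le_right _ _).trans (min_le_right _ _)
  rcases h η hη0 (by linarith) with h4 | h4 <;> linarith

include hnnd hwin hG in
/-- **Round 1: buffers and scale bounds in the limit.** Let `Y k → S` locally (`δ`-separated
sets, two-way `ε`-matching on every ball about `0`, eventually), `y ∈ S`, and suppose that
eventually every point of `Y k` of norm `≤ ‖y‖ + 1` is census-clean in `Y k` with scale `≤ R₀`.
Then `y` is buffered in `S`, not isolated, and its scale is `≤ R₀`. [folklore] -/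
theorem cche_limit_buf {Y : ℕ → Set (EuclideanSpace ℝ (Fin 3))} {S : Set (EuclideanSpace ℝ (Fin 3))}
    {δ R₀ : ℝ} (hδ : 0 < δ)
    (hYsep : ∀ k, ∀ p ∈ Y k, ∀ q ∈ Y k, p ≠ q → δ ≤ dist p q)
    (hSsep : ∀ p ∈ S, ∀ q ∈ S, p ≠ q → δ ≤ dist p q)
    (hlim : ∀ R ε : ℝ, 0 < ε → ∀ᶠ k in atTop, BallMatch ε R 0 (Y k) S)
    {y : EuclideanSpace ℝ (Fin 3)} (hy : y ∈ S)
    (hclean : ∀ᶠ k in atTop, ∀ q ∈ Y k, ‖q‖ ≤ ‖y‖ + 1 → G (Y k) q ∧ nnd (Y k) q ≤ R₀) :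
    (∀ z ∈ S, dist z y ≤ 61 / 50 * nnd S y ∨ 13 / 10 * nnd S y ≤ dist z y) ∧
      (S \ {y}).Nonempty ∧ nnd S y ≤ R₀ := by
  obtain ⟨hpY, hpy⟩ := hge_exists_approx hδ hYsep hlim hy
  have key : ∀ η : ℝ, 0 < η → 2 * η < δ →
      (S \ {y}).Nonempty ∧ nnd S y ≤ R₀ + 2 * η ∧
        ∀ z ∈ S, z ≠ y → dist z y < 13 / 10 * R₀ →
          (dist z y ≤ 61 / 50 * nnd S y + 5 * η ∨ 13 / 10 * nnd S y - 5 * η ≤ dist z y) := by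
    intro η hη h2η
    obtain ⟨k, hk1, hk2, hk3, hk4, hk5⟩ := (hpY.and ((Metric.tendsto_nhds.1 hpy η hη).and
      ((Metric.tendsto_nhds.1 hpy 1 one_pos).and ((hlim (‖y‖ + 3 * R₀ + 3) η hη).and
        hclean)))).exists
    have hpn : ‖nearPt (Y k) y‖ ≤ ‖y‖ + 1 := by
      linarith [hk3.le, norm_le_norm_add_dist (nearPt (Y k) y) y]
    obtain ⟨hCC, hd⟩ := hk5 _ hk1 hpn
    obtain ⟨hB, hW, -, -⟩ := (hG _ _).1 hCC
    exact cche_static_buf hnnd (hYsep k) hSsep hη h2η hk4 hk1 hy hk2.le hB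
      (cche_nonempty_of_win hwin hW) hd le_rfl
  obtain ⟨hne, -, -⟩ := key (δ / 4) (by positivity) (by linarith)
  have hdR : nnd S y ≤ R₀ := by
    refine le_of_forall_pos_le_add fun ε hε => ?_
    obtain ⟨-, h, -⟩ := key (min (ε / 2) (δ / 4)) (by positivity)
      (by linarith [min_le_right (ε / 2) (δ / 4)])
    linarith [min_le_left (ε / 2) (δ / 4)]
  refine ⟨fun z hz => ?_, hne, hdR⟩
  by_cases hzy : z = y
  · left
    rw [hzy, dist_self]
    exact mul_nonneg (by norm_num) (cche_nnd_nonneg hnnd S y)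
  by_cases hfar : 13 / 10 * R₀ ≤ dist z y
  · right
    linarith
  · rw [not_le] at hfar
    exact cche_or_of_forall_small (half_pos hδ) fun η hη hηδ =>
      (key η hη (by linarith)).2.2 z hz hzy hfar

/-! ## Round 2: the collar transfer (limit-free) -/

include hnnd hwin hrng hG in
/-- **Collar transfer of the census.** Let `X`, `X'` be `δ`-separated and two-way `η`-matched
on the ball of radius `R` about `0` (`200η ≤ δ`, `R` large compared with the two sites and their
scales), `p ∈ X`, `p' ∈ X'`, `dist p p' ≤ η`, `p'` not isolated in `X'`.  Suppose `p'` and all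
its window points are buffered in `X'`, and all window points of `p` are buffered in `X`.  If
`p` is census-clean in `X`, then `p'` is census-clean in `X'`: windows, rings and five-sets inject
into each other along the matching. [folklore] -/
theorem cche_clean_transfer {X X' : Set (EuclideanSpace ℝ (Fin 3))} {δ η R : ℝ}
    {p p' : EuclideanSpace ℝ (Fin 3)} (hδ : 0 < δ)
    (hsep : ∀ a ∈ X, ∀ b ∈ X, a ≠ b → δ ≤ dist a b)
    (hsep' : ∀ a ∈ X', ∀ b ∈ X', a ≠ b → δ ≤ dist a b)
    (hη : 0 < η) (hηδ : 200 * η ≤ δ) (hM : BallMatch η R 0 X X')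
    (hp : p ∈ X) (hp' : p' ∈ X') (hpp' : dist p p' ≤ η)
    (hR : ‖p‖ + 4 * nnd X p + 4 ≤ R) (hR' : ‖p'‖ + 4 * nnd X' p' + 4 ≤ R)
    (hne' : (X' \ {p'}).Nonempty)
    (hB' : ∀ z ∈ X', dist z p' ≤ 61 / 50 * nnd X' p' ∨ 13 / 10 * nnd X' p' ≤ dist z p')
    (hBw' : ∀ z' ∈ win X' p', ∀ w ∈ X',
      dist w z' ≤ 61 / 50 * nnd X' z' ∨ 13 / 10 * nnd X' z' ≤ dist w z')
    (hBw : ∀ z ∈ win X p, ∀ w ∈ X, dist w z ≤ 61 / 50 * nnd X z ∨ 13 / 10 * nnd X z ≤ dist w z)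
    (hCC : G X p) : G X' p' := by
  obtain ⟨hB, hW, hRing, hFive⟩ := (hG _ _).1 hCC
  have hne : (X \ {p}).Nonempty := cche_nonempty_of_win hwin hW
  have h2η : 2 * η < δ := by linarith
  have hp'p : dist p' p ≤ η := by rwa [dist_comm]
  have hM1 : ∀ s ∈ X', ‖s‖ ≤ R → ∃ a ∈ X, dist a s ≤ η := fun s hs hsR =>
    hM.1 s hs (by rwa [dist_zero_right])
  have hM2 : ∀ s ∈ X, ‖s‖ ≤ R → ∃ a ∈ X', dist a s ≤ η := fun s hs hsR => by
    obtain ⟨a, ha, has⟩ := hM.2 s hs (by rwa [dist_zero_right])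
    exact ⟨a, ha, by rwa [dist_comm]⟩
  have hmw : ∀ {T : Set (EuclideanSpace ℝ (Fin 3))} {c w : EuclideanSpace ℝ (Fin 3)},
      w ∈ win T c → w ∈ T ∧ w ≠ c ∧ dist w c ≤ 61 / 50 * nnd T c :=
    fun h => (cche_mem_win hwin).1 h
  -- scales at the two sites
  have hδd : δ ≤ nnd X p := cche_delta_le_nnd hnnd hsep hp hne
  have hδd' : δ ≤ nnd X' p' := cche_delta_le_nnd hnnd hsep' hp' hne'
  have hdd' : nnd X' p' ≤ nnd X p + 2 * η :=
    (cche_nnd_le_of_match hnnd hsep h2η hM2 hp hpp' hne (by linarith)).2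
  have hd'd : nnd X p ≤ nnd X' p' + 2 * η :=
    (cche_nnd_le_of_match hnnd hsep' h2η hM1 hp' hp'p hne' (by linarith)).2
  -- windows map into windows, both ways; window counts agree
  have hmaps : ∀ w ∈ win X p, ∃ w' ∈ win X' p', dist w' w ≤ η :=
    cche_win_mapsTo hnnd hwin hδ hsep hηδ hM2 hp hpp' hR hd'd hδd' hB'
  have hmaps' : ∀ w' ∈ win X' p', ∃ w ∈ win X p, dist w w' ≤ η :=
    cche_win_mapsTo hnnd hwin hδ hsep' hηδ hM1 hp' hp'p hR' hdd' hδd hB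
  have hfin : (win X p).Finite := cche_win_finite hwin hδ hsep
  have hfin' : (win X' p').Finite := cche_win_finite hwin hδ hsep'
  have hsw : ∀ a ∈ win X p, ∀ b ∈ win X p, a ≠ b → δ ≤ dist a b :=
    fun a ha b hb => hsep a (hmw ha).1 b (hmw hb).1
  have hsw' : ∀ a ∈ win X' p', ∀ b ∈ win X' p', a ≠ b → δ ≤ dist a b :=
    fun a ha b hb => hsep' a (hmw ha).1 b (hmw hb).1
  have hW' : (win X' p').ncard = 12 := by
    have h1 := cche_ncard_le_of_mapsTo hsw h2η hfin' hmaps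
    have h2 := cche_ncard_le_of_mapsTo hsw' h2η hfin hmaps'
    omega
  -- ring numbers agree at partner window points
  have hringEq : ∀ z ∈ win X p, ∀ z' ∈ win X' p', dist z' z ≤ η →
      (rng X' p' z').ncard = (rng X p z).ncard := by
    intro z hz z' hz' hzz'
    obtain ⟨hzX, hzp, hzd⟩ := hmw hz
    obtain ⟨hz'X, hz'p, hz'd⟩ := hmw hz'
    have hzz : dist z z' ≤ η := by rwa [dist_comm]
    have hzne : (X \ {z}).Nonempty := ⟨p, hp, fun h => hzp (Set.mem_singleton_iff.1 h).symm⟩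
    have hzne' : (X' \ {z'}).Nonempty :=
      ⟨p', hp', fun h => hz'p (Set.mem_singleton_iff.1 h).symm⟩
    have hδe : δ ≤ nnd X z := cche_delta_le_nnd hnnd hsep hzX hzne
    have hδe' : δ ≤ nnd X' z' := cche_delta_le_nnd hnnd hsep' hz'X hzne'
    have hez : nnd X z ≤ 61 / 50 * nnd X p :=
      (cche_nnd_le hnnd hp hzp.symm).trans (by rwa [dist_comm])
    have hez' : nnd X' z' ≤ 61 / 50 * nnd X' p' :=
      (cche_nnd_le hnnd hp' hz'p.symm).trans (by rwa [dist_comm])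
    have hzR : ‖z‖ + nnd X z + 1 ≤ R := by linarith [norm_le_norm_add_dist z p]
    have hz'R : ‖z'‖ + nnd X' z' + 1 ≤ R := by linarith [norm_le_norm_add_dist z' p']
    have hee' : nnd X' z' ≤ nnd X z + 2 * η :=
      (cche_nnd_le_of_match hnnd hsep h2η hM2 hzX hzz hzne hzR).2
    have he'e : nnd X z ≤ nnd X' z' + 2 * η :=
      (cche_nnd_le_of_match hnnd hsep' h2η hM1 hz'X hzz' hzne' hz'R).2
    have hrm : ∀ w ∈ rng X p z, ∃ w' ∈ rng X' p' z', dist w' w ≤ η :=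
      cche_ring_mapsTo hwin hrng hδ hsep hηδ hmaps hz hzz' he'e hδe' (hBw' z' hz')
    have hrm' : ∀ w' ∈ rng X' p' z', ∃ w ∈ rng X p z, dist w w' ≤ η :=
      cche_ring_mapsTo hwin hrng hδ hsep' hηδ hmaps' hz' hzz hee' hδe (hBw z hz)
    have h1 := cche_ncard_le_of_mapsTo (fun a ha b hb => hsw a ((cche_mem_rng hrng).1 ha).1 b
      ((cche_mem_rng hrng).1 hb).1) h2η (hfin'.subset fun w hw => ((cche_mem_rng hrng).1 hw).1) hrm
    have h2 := cche_ncard_le_of_mapsTo (fun a ha b hb => hsw' a ((cche_mem_rng hrng).1 ha).1 b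
      ((cche_mem_rng hrng).1 hb).1) h2η (hfin.subset fun w hw => ((cche_mem_rng hrng).1 hw).1) hrm'
    omega
  -- ring numbers and fives transfer
  have hRing' : ∀ z' ∈ win X' p', (rng X' p' z').ncard = 4 ∨ (rng X' p' z').ncard = 5 := by
    intro z' hz'
    obtain ⟨z, hz, hzz'⟩ := hmaps' z' hz'
    rw [hringEq z hz z' hz' (by rwa [dist_comm])]
    exact hRing z hz
  have hF1 : ∀ z ∈ {z : EuclideanSpace ℝ (Fin 3) | z ∈ win X p ∧ (rng X p z).ncard = 5},
      ∃ z' ∈ {z' : EuclideanSpace ℝ (Fin 3) | z' ∈ win X' p' ∧ (rng X' p' z').ncard = 5},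
        dist z' z ≤ η := by
    intro z hz
    obtain ⟨z', hz', hzz'⟩ := hmaps z hz.1
    exact ⟨z', ⟨hz', by rw [hringEq z hz.1 z' hz' hzz']; exact hz.2⟩, hzz'⟩
  have hF2 : ∀ z' ∈ {z' : EuclideanSpace ℝ (Fin 3) | z' ∈ win X' p' ∧ (rng X' p' z').ncard = 5},
      ∃ z ∈ {z : EuclideanSpace ℝ (Fin 3) | z ∈ win X p ∧ (rng X p z).ncard = 5},
        dist z z' ≤ η := by
    intro z' hz'
    obtain ⟨z, hz, hzz'⟩ := hmaps' z' hz'.1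
    exact ⟨z, ⟨hz, by rw [← hringEq z hz z' hz'.1 (by rwa [dist_comm])]; exact hz'.2⟩, hzz'⟩
  have hFive' : {z' : EuclideanSpace ℝ (Fin 3) | z' ∈ win X' p' ∧ (rng X' p' z').ncard = 5}.ncard =
      {z : EuclideanSpace ℝ (Fin 3) | z ∈ win X p ∧ (rng X p z).ncard = 5}.ncard := by
    have h1 := cche_ncard_le_of_mapsTo (fun a ha b hb => hsw a ha.1 b hb.1) h2η
      (hfin'.subset fun w hw => hw.1) hF1
    have h2 := cche_ncard_le_of_mapsTo (fun a ha b hb => hsw' a ha.1 b hb.1) h2η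
      (hfin.subset fun w hw => hw.1) hF2
    omega
  refine (hG _ _).2 ⟨hB', hW', hRing', ?_⟩
  rw [hFive']
  exact hFive

/-! ## The exactification -/

include hnnd hwin hrng hG in
/-- **Census-clean hull element, parametrised form.** If the census-dirty fraction of a sequence
of Lennard-Jones ground states tends to `0`, some local limit `S ∋ 0` of translates along a
subsequence is `δ`-separated and every `y ∈ S` is census-clean with scale `≤ R₀` (Steps 1–3 and
5 verbatim from `agce_clean_generic`; Step 4 = the two rounds `cche_limit_buf`,
`cche_clean_transfer`). [folklore] -/
theorem cche_clean_generic (x : (N : ℕ) → (Fin N → EuclideanSpace ℝ (Fin 3)))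
    (hx : ∀ N, IsGroundState lennardJones (x N))
    (hbad : Tendsto (fun N : ℕ =>
      (Nat.card {i : Fin N // ¬ G (Set.range (x N)) (x N i)} : ℝ) / (N : ℝ)) atTop (𝓝 (0 : ℝ))) :
    ∃ S : Set (EuclideanSpace ℝ (Fin 3)), ∃ δ R₀ : ℝ, 0 < δ ∧
      (∀ y ∈ S, ∀ z ∈ S, y ≠ z → δ ≤ dist y z) ∧ (0 : EuclideanSpace ℝ (Fin 3)) ∈ S ∧
      (∃ φ : ℕ → ℕ, StrictMono φ ∧ ∃ τ : ℕ → EuclideanSpace ℝ (Fin 3), ∀ R ε : ℝ, 0 < ε →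
        ∀ᶠ j : ℕ in atTop,
          (∀ s ∈ S, ‖s‖ ≤ R → ∃ i : Fin (φ j), dist (x (φ j) i + τ j) s ≤ ε) ∧
          (∀ i : Fin (φ j), ‖x (φ j) i + τ j‖ ≤ R → ∃ s ∈ S, dist (x (φ j) i + τ j) s ≤ ε)) ∧
      (∀ y ∈ S, G S y ∧ nnd S y ≤ R₀) := by
  classical
  obtain ⟨δ, hδ, hsepall⟩ := LennardJonesMinimalDistance_holds
  obtain ⟨R₀, hR₀, hbond⟩ := hge_exists_bond_radius
  -- Step 1: clean centres of every radius `k`, eventually in `N`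
  have hclean : ∀ k : ℕ, ∀ᶠ N in atTop, ∃ i : Fin N, ∀ j : Fin N,
      dist (x N j) (x N i) ≤ k → G (Set.range (x N)) (x N j) := by
    intro k
    set M : ℝ := (2 * (k : ℝ) / δ + 1) ^ 3 with hM
    have ht := hbad.const_mul M
    rw [mul_zero] at ht
    filter_upwards [ht.eventually_lt_const zero_lt_one, eventually_gt_atTop 0] with N hN1 hN0
    have hNpos : (0 : ℝ) < N := by exact_mod_cast hN0
    set D : Finset (Fin N) := Finset.univ.filter fun i => ¬ G (Set.range (x N)) (x N i) with hD
    have hcardD : (D.card : ℝ) = Nat.card {i : Fin N // ¬ G (Set.range (x N)) (x N i)} := by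
      rw [Nat.card_eq_fintype_card, Fintype.card_subtype]
    have hlt : (D.card : ℝ) * (2 * (k : ℝ) / δ + 1) ^ 3 < N := by
      rw [hcardD, ← hM]
      rw [← mul_div_assoc, mul_comm] at hN1
      rwa [div_lt_iff₀ hNpos, one_mul] at hN1
    obtain ⟨i, hi⟩ := hb_exists_far_from (x N) hδ (Nat.cast_nonneg k) (hsepall N (x N) (hx N)) D hlt
    refine ⟨i, fun j hj => ?_⟩
    by_contra hbadj
    exact hi j hj (Finset.mem_filter.2 ⟨Finset.mem_univ _, hbadj⟩)
  -- Step 2: diagonal choice of radii and recentring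
  obtain ⟨φ₀, hφ₀, hcen⟩ := extraction_forall_of_eventually hclean
  choose ic hic using hcen
  set c : ℕ → EuclideanSpace ℝ (Fin 3) := fun k => -x (φ₀ k) (ic k) with hc
  set Y : ℕ → Set (EuclideanSpace ℝ (Fin 3)) := fun k => Set.range fun j => x (φ₀ k) j + c k with hY
  have hYsep : ∀ k, ∀ p ∈ Y k, ∀ q ∈ Y k, p ≠ q → δ ≤ dist p q := by
    intro k
    rintro _ ⟨j, rfl⟩ _ ⟨j', rfl⟩ hne
    rw [dist_add_right]
    exact hsepall _ _ (hx _) j j' fun h => hne (by simp [h])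
  -- Step 3: compactness; `0 ∈ S`; clean balls in the recentred configurations
  obtain ⟨φ₁, S, hφ₁, hSsep, hlim⟩ := exists_subseq_forall_eventually_ballMatch hδ Y hYsep
  have hYsepφ : ∀ k, ∀ p ∈ Y (φ₁ k), ∀ q ∈ Y (φ₁ k), p ≠ q → δ ≤ dist p q := fun k => hYsep (φ₁ k)
  have h0Y : ∀ k, (0 : EuclideanSpace ℝ (Fin 3)) ∈ Y k := fun k => ⟨ic k, by simp [hc]⟩
  have h0S : (0 : EuclideanSpace ℝ (Fin 3)) ∈ S :=
    hge_mem_of_tendsto hδ hSsep hlim (Eventually.of_forall fun k => h0Y (φ₁ k)) tendsto_const_nhds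
  have hcleanY : ∀ k, ∀ q ∈ Y (φ₁ k), ‖q‖ ≤ k → G (Y (φ₁ k)) q ∧ nnd (Y (φ₁ k)) q ≤ R₀ := by
    intro k q hq hqk
    obtain ⟨j, hj⟩ := hq
    have hj' : x (φ₀ (φ₁ k)) j + c (φ₁ k) = q := hj
    have hdist : dist (x (φ₀ (φ₁ k)) j) (x (φ₀ (φ₁ k)) (ic (φ₁ k))) ≤ (φ₁ k : ℕ) := by
      have e : dist (x (φ₀ (φ₁ k)) j) (x (φ₀ (φ₁ k)) (ic (φ₁ k))) = ‖q‖ := by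
        rw [← hj', dist_eq_norm]
        simp only [hc, sub_eq_add_neg]
      rw [e]
      have hkk : (k : ℝ) ≤ (φ₁ k : ℕ) := by exact_mod_cast hφ₁.id_le k
      linarith
    have := cche_particle hnnd hwin hrng hG (hx _).1 (hbond _ _ (hx _)) (hic (φ₁ k) j hdist)
      (c (φ₁ k))
    rw [hj'] at this
    exact this
  have hcleanB : ∀ B : ℝ, ∀ᶠ k in atTop, ∀ q ∈ Y (φ₁ k), ‖q‖ ≤ B →
      G (Y (φ₁ k)) q ∧ nnd (Y (φ₁ k)) q ≤ R₀ := fun B => by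
    filter_upwards [tendsto_natCast_atTop_atTop.eventually_ge_atTop B] with k hk q hq hqB
    exact hcleanY k q hq (hqB.trans hk)
  -- Step 4, round 1: buffers and scale bounds at every point of `S`
  have hBufS : ∀ y ∈ S, (∀ z ∈ S, dist z y ≤ 61 / 50 * nnd S y ∨ 13 / 10 * nnd S y ≤ dist z y) ∧
      (S \ {y}).Nonempty ∧ nnd S y ≤ R₀ :=
    fun y hyS => cche_limit_buf hnnd hwin hG hδ hYsepφ hSsep hlim hyS (hcleanB _)
  -- Step 4, round 2: the census at every point of `S`, by one collar transfer
  have hgoodS : ∀ y ∈ S, G S y ∧ nnd S y ≤ R₀ := by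
    intro y hyS
    obtain ⟨hBy, hney, hdy⟩ := hBufS y hyS
    obtain ⟨hpY, hpy⟩ := hge_exists_approx hδ hYsepφ hlim hyS
    have hη0 : 0 < δ / 200 := by positivity
    obtain ⟨k, hk1, hk2, hk3, hk4, hk5⟩ := (hpY.and ((Metric.tendsto_nhds.1 hpy _ hη0).and
      ((Metric.tendsto_nhds.1 hpy 1 one_pos).and ((hlim (‖y‖ + 4 * R₀ + 6) (δ / 200) hη0).and
        (hcleanB (‖y‖ + 2 * R₀ + 2)))))).exists
    have hpn : ‖nearPt (Y (φ₁ k)) y‖ ≤ ‖y‖ + 1 := by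
      linarith [hk3.le, norm_le_norm_add_dist (nearPt (Y (φ₁ k)) y) y]
    obtain ⟨hCC, hd⟩ := hk5 _ hk1 (by linarith)
    refine ⟨cche_clean_transfer hnnd hwin hrng hG hδ (hYsepφ k) hSsep hη0 (by linarith) hk4 hk1
      hyS hk2.le (by linarith) (by linarith) hney hBy (fun z' hz' => (hBufS z'
        ((cche_mem_win hwin).1 hz').1).1) (fun z hz => ?_) hCC, hdy⟩
    obtain ⟨hzY, -, hzd⟩ := (cche_mem_win hwin).1 hz
    have hzn : ‖z‖ ≤ ‖y‖ + 2 * R₀ + 2 := by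
      linarith [norm_le_norm_add_dist z (nearPt (Y (φ₁ k)) y)]
    exact ((hG _ _).1 (hk5 z hzY hzn).1).1
  -- Step 5: assemble
  refine ⟨S, δ, R₀, hδ, hSsep, h0S, ⟨fun j => φ₀ (φ₁ j), hφ₀.comp hφ₁, fun j => c (φ₁ j), ?_⟩,
    hgoodS⟩
  intro R ε hε
  filter_upwards [hlim R ε hε] with j hj
  exact (ballMatch_zero_range_iff (fun i => x (φ₀ (φ₁ j)) i + c (φ₁ j)) ε R).1 hj

/-! ## The stub -/

/-- **STUB B of line `census-liouville` — census-clean hull element with bounded scale**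
(exactification no. 1 for the wide-window link census).  If the census-dirty fraction of a
sequence of Lennard-Jones ground states in `ℝ³` tends to `0`, some hull element `S ∋ 0` of it
(two-way matching of translates along a subsequence on every ball) is `δ`-separated and every
`y ∈ S` is census-clean with local scale `sInf (dist · y '' (S ∖ {y})) ≤ R₀`:
`cche_clean_generic` with `G := CC` and the census pieces read off the line's `let`s (all
defining equations hold by `rfl`). [folklore] -/
theorem stub_censusCleanHullElement : let CC : Set (EuclideanSpace ℝ (Fin 3)) → EuclideanSpace ℝ (Fin 3) → Prop := fun S y => let d : ℝ := sInf ((fun z => dist z y) '' (S \ {y})); let T : Set (EuclideanSpace ℝ (Fin 3)) := {z : EuclideanSpace ℝ (Fin 3) | z ∈ S ∧ z ≠ y ∧ dist z y ≤ 61 / 50 * d}; (∀ z ∈ S, dist z y ≤ 61 / 50 * d ∨ 13 / 10 * d ≤ dist z y) ∧ T.ncard = 12 ∧ (∀ z ∈ T, ({w : EuclideanSpace ℝ (Fin 3) | w ∈ T ∧ w ≠ z ∧ dist w z ≤ 61 / 50 * sInf ((fun v => dist v z) '' (S \ {z}))} : Set (EuclideanSpace ℝ (Fin 3))).ncard = 4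 ∨ ({w : EuclideanSpace ℝ (Fin 3) | w ∈ T ∧ w ≠ z ∧ dist w z ≤ 61 / 50 * sInf ((fun v => dist v z) '' (S \ {z}))} : Set (EuclideanSpace ℝ (Fin 3))).ncard = 5) ∧ (({z : EuclideanSpace ℝ (Fin 3) | z ∈ T ∧ ({w : EuclideanSpace ℝ (Fin 3) | w ∈ T ∧ w ≠ z ∧ dist w z ≤ 61 / 50 * sInf ((fun v => dist v z) '' (S \ {z}))} : Set (EuclideanSpace ℝ (Fin 3))).ncard = 5} : Set (EuclideanSpace ℝ (Fin 3))).ncard = 0 ∨ ({z : EuclideanSpace ℝ (Fin 3) | z ∈ T ∧ ({w : EuclideanSpace ℝ (Fin 3) | w ∈ T ∧ w ≠ z ∧ dist w z ≤ 61 / 50 * sInf ((fun v => dist v z) '' (S \ {z}))} : Set (EuclideanSpace ℝ (Fin 3))).ncard = 5} : Set (EuclideanSpace ℝ (Fin 3))).ncard = 2); let HL : ((N : ℕ) → (Fin N → EuclideanSpace ℝ (Fin 3))) → Set (EuclideanSpace ℝ (Fin 3)) → Prop := fun x S => ∃ φ : ℕ → ℕ, StrictMono φ ∧ ∃ τ :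 ℕ → EuclideanSpace ℝ (Fin 3), ∀ R ε : ℝ, 0 < ε → ∀ᶠ j : ℕ in Filter.atTop, (∀ s ∈ S, ‖s‖ ≤ R → ∃ i : Fin (φ j), dist (x (φ j) i + τ j) s ≤ ε) ∧ (∀ i : Fin (φ j), ‖x (φ j) i + τ j‖ ≤ R → ∃ s ∈ S, dist (x (φ j) i + τ j) s ≤ ε); ∀ (x : (N : ℕ) → (Fin N → EuclideanSpace ℝ (Fin 3))), (∀ N, Literature.MathematicalPhysics.StatisticalMechanics.IsGroundState Literature.MathematicalPhysics.StatisticalMechanics.lennardJones (x N)) → Filter.Tendsto (fun N : ℕ => (Nat.card {i : Fin N // ¬ CC (Set.range (x N)) (x N i)} : ℝ) / (N : ℝ)) Filter.atTop (nhds (0 : ℝ)) → ∃ S : Set (EuclideanSpace ℝ (Fin 3)), ∃ δ R₀ : ℝ, 0 < δ ∧ (∀ y ∈ S, ∀ z ∈ S, y ≠ z → δ ≤ dist y z) ∧ (0 : EuclideanSpace ℝ (Fin 3)) ∈ S ∧ HL x S ∧ (∀ y ∈ S, CC S y ∧ sInf ((fun z => dist z y) '' (S \ {y})) ≤ R₀)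 := by
  intro CC HL x hx hbad
  exact cche_clean_generic (G := CC) (fun _ _ => rfl) (fun _ _ => rfl) (fun _ _ _ => rfl)
    (fun _ _ => Iff.rfl) x hx hbad

end Summit.AtomisticToContinuum.Crystallization.Theorems.AlphabetGoodHullElementCensusLiouville

end
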